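import Summits.BirchSwinnertonDyer.BirchSwinnertonDyer.Theorems.GenusKolyvaginAtTwoK4NegPhantomCellTopBits
import Summits.BirchSwinnertonDyer.BirchSwinnertonDyer.Theorems.GenusKolyvaginAtTwoK4NegPhantomCellDescentBit
import HarnessLib

/-!
# Route `GenusKolyvaginAtTwo`, crux K₄⁻ `K4Neg` (stmt-BirchSwinnertonDyer-31526), the phantom cell F4ᵖᵍ — THE HEEGNER DESCENT BIT,
# part 4: THE PLUG — LEAD gk2-p1 g28's `kFourNeg_shape_of_topBits` WITHOUT its `hDesc` hypothesis on every (α)-frame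

Seat `bsd-line-gk2-p3` g34 (PROVER seat 3/3, cell `bsd-f1-sign2`), `--supports stmt-BirchSwinnertonDyer-31526 --as helper`.
THEOREMS ONLY (no definition, no named fact, no `sorry`); standard axioms.  **BSD is NOT proved by this file; K4Neg is NOT proved;
nothing is closed.**  Conditional exactly like the LEAD's theorem on Q2 = `KolyvaginRelationAtTwo` (stmt-24880, a binder of `closes`).

WHAT.  `PlusDescent.kFourNeg_shape_of_topBits` (p786172) derives the K4Neg CONCLUSION SHAPE on the phantom cell from one sharp Selmer class
`s₀` with good top bits (`hS`, `hSY`) PLUS the Heegner descent bit `hDesc` at levels `(2^M, 2^(M+2))`.  Part 3 of this series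
(`PhantomDescentBit.hDesc_of_phantom_alive`, p789560) PROVES `hDesc` on every (α)-frame — `d_K` divisible by an odd good prime `ℓ₀` at which the
level-`2` Lawson–Wuthrich class `ξ` is alive (`[ξ, F·F] ≠ 0` for an arithmetic Frobenius `F` over `ℓ₀` with `F·F ∈ Γ_{ℚ(E[2])}`; part 1 p787963:
such prime Heegner frames exist beyond every bound) — given that every rational point is torsion (read in `E(ℚ̄)`; = `rank E(ℚ) = 0`, the K₄⁻
cell's `r_an = 0` through GZK).  This file is the composition: **`kFourNeg_shape_of_topBits_of_alive`** = the LEAD's theorem with `hDesc`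
REPLACED by the (α)-datum and the torsion hypothesis.  What remains on the phantom cell's (α)-frames: the supply of `s₀` (LEAD, in progress:
WALL + U₂ + Cassels–Tate).  The (β)-frames (`ξ` dead at `ℓ₀`) are the residual of this road.

References: [LawsonWuthrich2016] §3, §7.1; [McCallumLMS1991] §5 Thm. 5.4; [Kolyvagin1989Izv] Thm. B₂; [GrossLMS1991] §9.
-/

set_option autoImplicit false
set_option linter.dupNamespace false -- the Theorems namespace of this sub repeats the summit name by design (D-0017 nested layout)

noncomputable section

open scoped Classical AddSubgroup

namespace Summit.BirchSwinnertonDyer.BirchSwinnertonDyer.Theorems.GenusExact.PhantomDescentBit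

open WeierstrassCurve NumberField IsDedekindDomain Field Rat.HeightOneSpectrum Literature.NumberTheory.EllipticCurves
  Literature.NumberTheory.GaloisRepresentations Literature.NumberTheory.EllipticCurves.ModularForms AddSubgroup
  Literature.NumberTheory.EllipticCurves.RingClassField
open Summit.BirchSwinnertonDyer.BirchSwinnertonDyer.Theses.GenusKolyvaginAtTwo (KolyvaginRelationAtTwo)
open Summit.BirchSwinnertonDyer.BirchSwinnertonDyer.Theorems.GenusExact
open Summit.BirchSwinnertonDyer.BirchSwinnertonDyer.Theorems.GenusExact.PlusDescent

/-- ★★ **K4Neg's CONCLUSION SHAPE ON AN (α)-FRAME OF THE PHANTOM CELL, `hDesc` DISCHARGED** (modulo Q2).  The LEAD's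
`PlusDescent.kFourNeg_shape_of_topBits` VERBATIM (frame: `E/ℚ` globally minimal, non-CM, `Δ < 0`, odd Tamagawa product, `ρ_{E,2^n}` onto; `K` imaginary
quadratic, `d_K` odd `≠ −3`, Heegner, the two Theorem-B₂ non-squares; `d₁` with `K`-rational point `y_K`, `2^(M₀+1) ∤ P(1)`; `w(E) = +1`; one sharp
`s₀ ∈ Sel_(2^M)(E/ℚ)`, `M ≥ M₀ + 1`, with the top-bit hypotheses `hS`, `hSY`), with its descent hypothesis `hDesc` REPLACED by:
an odd good prime `ℓ₀ ∣ d_K` at which a non-zero `ξ ∈ H¹(ℚ, E[2])` dying on `Γ_{ℚ(E[4])}` is ALIVE (`F` arithmetic Frobenius at a prime over `ℓ₀`,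
`F·F ∈ Γ_{ℚ(E[2])}`, `[ξ, F·F] ≠ 0` — part 1 `exists_levelFour_phantom_twistingPrime`), and «every point of `E(ℚ)` is torsion» read in `E(ℚ̄)`.
**Conclusion: `∃ n` square-free, `∃ d : KolyvaginHeegnerData Dt β ι n`, every `ℓ ∣ n` a Zhang–Kolyvagin prime at `2` of index `≥ 2` with
`FrobEqFrobInfty`, and `P(n) ∉ 2E(K[n])`.**  BSD is NOT proved; K4Neg is NOT proved (the supply of `s₀` and the (β)-frames remain).
[cite: LawsonWuthrich2016, §7.1] [cite: McCallumLMS1991, §5 Thm. 5.4] [cite: Kolyvagin1989Izv, Thm. B₂] -/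
theorem kFourNeg_shape_of_topBits_of_alive (hQ2 : KolyvaginRelationAtTwo)
    (W : WeierstrassCurve ℚ) [W.IsElliptic] [W.IsGloballyMinimal] [NeZero (W.conductorNorm ℤ)] (hcm : ¬ W.HasCM) (hneg : W.Δ < 0)
    (hT : Odd W.tamagawaProduct)
    (K : Type) [Field K] [NumberField K] (hIQ : IsImaginaryQuadratic K) (hodd : Odd (NumberField.discr K))
    (h3 : NumberField.discr K ≠ -3) (hHe : SatisfiesHeegnerHypothesis (W.conductorNorm ℤ) K)
    (hsq1 : ¬ IsSquare ((NumberField.discr K : ℚ) * -|W.Δ|)) (hsq2 : ¬ IsSquare ((NumberField.discr K : ℚ) * (-(2 * |W.Δ|))))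
    (hρ : ∀ n : ℕ, 0 < n → W.HasSurjectiveModNGaloisRep ((2 : ℤ) ^ n))
    (Dt : ModularParametrizationData W (W.conductorNorm ℤ)) (β : ℤ) (ι : K →+* ℂ) (d₁ : KolyvaginHeegnerData Dt β ι 1)
    (Ph : (W.baseChange K).toAffine.Point)
    (hPh : WeierstrassCurve.Affine.Point.map (W' := W) (algebraMap K (ringClassField K ι 1)).toRatAlgHom Ph = d₁.derivedPoint)
    (M₀ : ℕ) (hndiv : ¬ ∃ Q : (W.baseChange (ringClassField K ι 1)).toAffine.Point, ((2 ^ (M₀ + 1) : ℕ) : ℤ) • Q = d₁.derivedPoint)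
    (hw1 : W.rootNumber = 1)
    (M : ℕ) (hM₀M : M₀ + 1 ≤ M) (s₀ : galH1Torsion W ((2 ^ M : ℕ) : ℤ)) (hs₀ : s₀ ∈ selmerGroup W ((2 ^ M : ℕ) : ℤ))
    (hne : ((2 ^ (M₀ - 1) : ℕ) : ℤ) • s₀ ≠ 0)
    (hS : ∀ (hd : ((2 ^ M : ℕ) : ℤ) ∣ ((2 ^ (M + 2) : ℕ) : ℤ)) (a : ℤ),
      (2 : ℤ) • (a • torsionH1OfDvd (W.baseChange K) hd (resTorsion W K ((2 ^ M : ℕ) : ℤ) s₀)) = 0 →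
      (∀ ρ' ∈ torsionFixing (W.baseChange K) ((2 ^ (M + 2) : ℕ) : ℤ),
        h1Eval (W.baseChange K) ((2 ^ (M + 2) : ℕ) : ℤ) (a • torsionH1OfDvd (W.baseChange K) hd (resTorsion W K ((2 ^ M : ℕ) : ℤ) s₀)) ρ' = 0) →
      a • torsionH1OfDvd (W.baseChange K) hd (resTorsion W K ((2 ^ M : ℕ) : ℤ) s₀) = 0)
    (hSY : ∀ (hd : ((2 ^ M : ℕ) : ℤ) ∣ ((2 ^ (M + 2) : ℕ) : ℤ)) (a b : ℤ),
      (2 : ℤ) • (a • torsionH1OfDvd (W.baseChange K) hd (resTorsion W K ((2 ^ M : ℕ) : ℤ) s₀)) = 0 →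
      (2 : ℤ) • (b • torsionH1OfDvd (W.baseChange K) hd (d₁.kolyvaginClass Nat.prime_two M)) = 0 →
      a • torsionH1OfDvd (W.baseChange K) hd (resTorsion W K ((2 ^ M : ℕ) : ℤ) s₀) ≠ 0 →
      b • torsionH1OfDvd (W.baseChange K) hd (d₁.kolyvaginClass Nat.prime_two M) ≠ 0 →
      ∃ ρ' ∈ torsionFixing (W.baseChange K) ((2 ^ (M + 2) : ℕ) : ℤ),
        h1Eval (W.baseChange K) ((2 ^ (M + 2) : ℕ) : ℤ)
          (a • torsionH1OfDvd (W.baseChange K) hd (resTorsion W K ((2 ^ M : ℕ) : ℤ) s₀) +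
            b • torsionH1OfDvd (W.baseChange K) hd (d₁.kolyvaginClass Nat.prime_two M)) ρ' ≠ 0)
    -- the (α)-datum at an odd good prime `ℓ₀ ∣ d_K` (part 1 supplies it), replacing `hDesc`:
    {ℓ₀ : ℕ} [Fact ℓ₀.Prime] (hℓK : (ℓ₀ : ℤ) ∣ NumberField.discr K) (hΔℓ : ¬ (ℓ₀ : ℤ) ∣ minimalDiscriminantInt W)
    {ξ : galH1Torsion W (2 : ℤ)} (hξ0 : ξ ≠ 0) (hξ4 : ∀ h ∈ torsionFixing W (4 : ℤ), h1Eval W (2 : ℤ) ξ h = 0)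
    {v : HeightOneSpectrum (𝓞 ℚ)} (hv : (primesEquiv v : ℕ) = ℓ₀) {𝔓₀ : Ideal (absIntegers (𝓞 ℚ) ℚ)} (h𝔓₀ : 𝔓₀ ∈ v.primesAbove)
    {F : absoluteGaloisGroup ℚ} (hF : IsArithFrobAt (𝓞 ℚ) F 𝔓₀) (hF2 : F * F ∈ torsionFixing W (2 : ℤ))
    (hval : h1Eval W (2 : ℤ) ξ (F * F) ≠ 0)
    -- every rational point is torsion (rank `0`), read in `E(ℚ̄)`:
    (htor : ∀ s : W.toAffine.Point, IsOfFinAddOrder (WeierstrassCurve.toGeomPoints W s)) :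
    ∃ (n : ℕ) (d : KolyvaginHeegnerData Dt β ι n), Squarefree n ∧
      (∀ ℓ ∈ n.primeFactors, Zhang2014.IsKolyvaginPrime (W.conductorNorm ℤ) W K 2 ℓ ∧ 2 ≤ Zhang2014.kolyvaginIndex W 2 ℓ ∧
        FrobEqFrobInfty W K 2 ℓ) ∧
      ¬ ∃ Q : (W.baseChange (ringClassField K ι n)).toAffine.Point, (2 : ℤ) • Q = d.derivedPoint :=
  kFourNeg_shape_of_topBits hQ2 W hcm hneg hT K hIQ hodd h3 hHe hsq1 hsq2 hρ Dt β ι d₁ Ph hPh M₀ hndiv hw1 M hM₀M s₀ hs₀ hne hS hSY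
    (hDesc_of_phantom_alive W hρ hIQ hodd hsq1 hsq2 hℓK hΔℓ hξ0 hξ4 hv h𝔓₀ hF hF2 hval
      (forall_fixed_odd_torsion_of_rank_zero W hρ hIQ htor) Ph (M := M) (L := M + 2) (by omega) (by omega))

end Summit.BirchSwinnertonDyer.BirchSwinnertonDyer.Theorems.GenusExact.PhantomDescentBit

end
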